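import Summits.Parity.BatemanHorn.Theorems.RoughParitySectorsOddSectorShareLinearSieveDecouplingOddAux2
import HarnessLib

/-!
# Route `RoughParitySectors`, crux `OddSectorShareLinear` (stmt-Parity-15629), line `birth`:
# helpers III for the stub `stub_sieveDecouplingOdd_of_roughCellsBV` — the odd decoupling sieve at a fixed height

`--supports stmt-Parity-15629`.  The odd-side twin of `SieveDecoupling.sieve_at`
(`…SieveDecouplingPrimeAux3`).  At a fixed height `x`, sifting level `z' ≥ 2` (`z = ⌈z'⌉ > α, β`)
and level of distribution `D ≥ z'`, the `(k−1)`-dimensional sieve of the stub S'b is carried out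
(`SieveDecouplingOdd.sieve_at`): the sequence `ℬ = {1 ≤ n ≤ x : f_m(n) > 0 free of primes < z,
Ω(f_m(n)) odd}` (`f_m = αX + β`), encoded by `N(n) = ∏_{p < z, n mod p ∈ Ω p} p` and sifted by the
primes `< z`, has `S(ℬ, z) = O + O(n₀)` (`O` = member `m`'s odd cell inside the jointly rough set),
main term `X V(z)` with `X = #{b ∈ roughIcc z (αx+β) : Ω(b) odd}/φ(α)`,
`V(z) = W = ∏_{p<z} (1 − #Ω p/#Φ p)`, and remainders `|R_d| ≤ S^{ω(d)} E(αd)` whenever `E(q)`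
bounds the discrepancies of the odd `z`-rough numbers `≤ αx + β` in the reduced classes modulo `q`
(`SieveDecouplingOdd.abs_card_classes_sub_le`, `Aux2`).  With the tree's uniform Fundamental Lemma
(constant `C₀`) this gives
`|O − W N| ≤ n₀ + C₀ e^{−log D/log z'} W (N + E(α)) + ∑_{d ∣ P(z'), d ≤ D} S^{ω(d)} E(αd) + W E(α)`,
`N = #ℬ`, consumed by the stub file (where `E` comes from the rough-cell Bombieri–Vinogradov
hypothesis).
-/

noncomputable section

open Filter Finset Polynomial
open scoped BigOperators
open Literature.NumberTheory.Sieve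

namespace Summit.Parity.BatemanHorn.Cruxes.OddSectorShareLinear.Birth

namespace SieveDecouplingOdd

open IntervalClassSieve (prime_dvd_classProd_iff classProd_pos classProd_le dvd_iff_forall_primeFactors)
open SieveDecoupling (sifted_eq congrSum_eq isUnit_linear_class)

variable {k : ℕ} {f : Fin k → ℤ[X]} {m : Fin k} {Ω Φ : ℕ → Finset ℕ} {α β : ℤ}

/-- **The odd decoupling sieve at a fixed height.**  With the uniform Fundamental Lemma (constant
`C₀`) for the dimension data `(κ, K)` of the density `g(d) = ∏_{p ∣ d} #Ω p/#Φ p`, sifting level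
`z' ≥ 2` (`z = ⌈z'⌉ > α, β`), level of distribution `D ≥ z'`, and a bound `E(q)` for the
discrepancies of the odd `z`-rough numbers `≤ αx + β` in the reduced classes modulo every `q ≥ 1`:
`|O − W N| ≤ n₀ + C₀ e^{−log D/log z'} W (N + E(α)) + ∑_{d ∣ P(z'), d ≤ D} S^{ω(d)} E(αd) + W E(α)`,
where `O` is member `m`'s odd cell inside the jointly `z`-rough set,
`N = #{n ≤ x : f_m(n) > 0 z-rough, Ω(f_m(n)) odd}`, `W = ∏_{p < z} (1 − g(p))` (sequence
`a_v = #{n ∈ ℬ : N(n) = v}`, `N(n) = ∏_{p<z, n mod p ∈ Ω p} p`, size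
`#{b ∈ roughIcc z (αx+β) : Ω(b) odd}/φ(α)`; `S(ℬ, z) = O + O(n₀)`, `abs_card_classes_sub_le` for the
remainders, the class `0 mod 1` for `N`). [folklore] -/
theorem sieve_at (hf : IsBatemanHornSystem f)
    (hΩ : ∀ p, Ω p = (range p).filter (fun c : ℕ => ¬ ((p : ℤ) ∣ (f m).eval (c : ℤ)) ∧
      ∃ i, i ≠ m ∧ (p : ℤ) ∣ (f i).eval (c : ℤ)))
    (hΦ : ∀ p, Φ p = (range p).filter (fun c : ℕ => ¬ ((p : ℤ) ∣ (f m).eval (c : ℤ))))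
    (hα : 0 < α) (hfm : ∀ n : ℤ, (f m).eval n = α * n + β)
    (hαβ : ∀ p : ℕ, p.Prime → (p : ℤ) ∣ α → ¬ ((p : ℤ) ∣ β))
    {g : ArithmeticFunction ℝ}
    (hg : ∀ d : ℕ, d ≠ 0 → g d = ∏ p ∈ d.primeFactors, (#(Ω p) : ℝ) / (#(Φ p) : ℝ))
    {κ K C₀ : ℝ} (hdim : HasSieveDimension g κ K) (hC₀ : 0 ≤ C₀)
    (hFL : ∀ A : SieveSequence, HasSieveDimension A.density κ K → ∀ x z D : ℝ, 2 ≤ z → z ≤ D →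
      0 ≤ A.size x →
      |A.sifted x (primesProdBelow z) - A.size x * A.densityProduct (primesProdBelow z)| ≤
        C₀ * A.size x * A.densityProduct (primesProdBelow z) *
            Real.exp (-(Real.log D / Real.log z)) +
          ∑ d ∈ (primesProdBelow z).divisors.filter (fun d : ℕ => (d : ℝ) ≤ D), |A.remainder d x|)
    {S : ℕ} (hS : ∀ p : ℕ, p.Prime → #(Ω p) ≤ S)
    {n₀ : ℕ} (hn₀ : ∀ i, ∀ n : ℕ, n₀ ≤ n → 0 < (f i).eval (n : ℤ))
    {E : ℕ → ℝ} {x : ℕ} {z' D : ℝ} (hz' : 2 ≤ z') (hzD : z' ≤ D) (hzβ : β < ⌈z'⌉₊)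
    (hzα : α < ⌈z'⌉₊)
    (hE : ∀ q a : ℕ, 0 < q → a.Coprime q →
      |(#((roughIcc ⌈z'⌉₊ (α * x + β).toNat).filter (fun b : ℕ =>
          Odd (ArithmeticFunction.cardFactors b) ∧ b ≡ a [MOD q])) : ℝ) -
        (#((roughIcc ⌈z'⌉₊ (α * x + β).toNat).filter (fun b : ℕ =>
          Odd (ArithmeticFunction.cardFactors b) ∧ b.Coprime q)) : ℝ) / Nat.totient q| ≤ E q) :
    |(#(((Icc 1 x).filter (fun n : ℕ => ∀ i, 0 < (f i).eval (n : ℤ) ∧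
        ∀ p ∈ range ⌈z'⌉₊, p.Prime → ¬ ((p : ℤ) ∣ (f i).eval (n : ℤ)))).filter
        (fun n : ℕ => Odd (ArithmeticFunction.cardFactors (((f m).eval (n : ℤ)).toNat)))) : ℝ) -
      (∏ p ∈ Nat.primesBelow ⌈z'⌉₊, (1 - g p)) *
        #((Icc 1 x).filter (fun n : ℕ => (0 < (f m).eval (n : ℤ) ∧
          ∀ p ∈ range ⌈z'⌉₊, p.Prime → ¬ ((p : ℤ) ∣ (f m).eval (n : ℤ))) ∧
          Odd (ArithmeticFunction.cardFactors (((f m).eval (n : ℤ)).toNat))))| ≤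
      n₀ + C₀ * Real.exp (-(Real.log D / Real.log z')) * (∏ p ∈ Nat.primesBelow ⌈z'⌉₊, (1 - g p)) *
          ((#((Icc 1 x).filter (fun n : ℕ => (0 < (f m).eval (n : ℤ) ∧
            ∀ p ∈ range ⌈z'⌉₊, p.Prime → ¬ ((p : ℤ) ∣ (f m).eval (n : ℤ))) ∧
            Odd (ArithmeticFunction.cardFactors (((f m).eval (n : ℤ)).toNat)))) : ℝ) +
            E α.toNat) +
        (∑ d ∈ (primesProdBelow z').divisors.filter (fun d : ℕ => (d : ℝ) ≤ D),
            (S : ℝ) ^ ArithmeticFunction.cardDistinctFactors d * E (α.toNat * d)) +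
        (∏ p ∈ Nat.primesBelow ⌈z'⌉₊, (1 - g p)) * E α.toNat := by
  -- abbreviations
  obtain ⟨z, hz⟩ : ∃ z : ℕ, z = ⌈z'⌉₊ := ⟨_, rfl⟩
  obtain ⟨y, hy⟩ : ∃ y : ℕ, y = (α * x + β).toNat := ⟨_, rfl⟩
  rw [← hz] at hzβ hzα hE ⊢
  rw [← hy] at hE
  obtain ⟨W, hW⟩ : ∃ W : ℝ, W = ∏ p ∈ Nat.primesBelow z, (1 - g p) := ⟨_, rfl⟩
  obtain ⟨Pset, hPset⟩ : ∃ Pset : Finset ℕ, Pset = ((Icc 1 x).filter (fun n : ℕ => ∀ i,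
      0 < (f i).eval (n : ℤ) ∧ ∀ p ∈ range z, p.Prime → ¬ ((p : ℤ) ∣ (f i).eval (n : ℤ)))).filter
      (fun n : ℕ => Odd (ArithmeticFunction.cardFactors (((f m).eval (n : ℤ)).toNat))) := ⟨_, rfl⟩
  obtain ⟨Qset, hQset⟩ : ∃ Qset : Finset ℕ, Qset = (Icc 1 x).filter (fun n : ℕ =>
      (0 < (f m).eval (n : ℤ) ∧ ∀ p ∈ range z, p.Prime → ¬ ((p : ℤ) ∣ (f m).eval (n : ℤ))) ∧
        Odd (ArithmeticFunction.cardFactors (((f m).eval (n : ℤ)).toNat))) := ⟨_, rfl⟩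
  obtain ⟨E₁, hE₁⟩ : ∃ E₁ : ℝ, E₁ = E α.toNat := ⟨_, rfl⟩
  obtain ⟨R, hR⟩ : ∃ R : ℝ, R = ∑ d ∈ (primesProdBelow z').divisors.filter (fun d : ℕ => (d : ℝ) ≤ D),
      (S : ℝ) ^ ArithmeticFunction.cardDistinctFactors d * E (α.toNat * d) := ⟨_, rfl⟩
  rw [← hW, ← hPset, ← hQset, ← hE₁, ← hR]
  have hQset' : Qset = (Icc 1 x).filter (fun n : ℕ => (0 < α * n + β ∧
      ∀ p ∈ range z, p.Prime → ¬ ((p : ℤ) ∣ α * n + β)) ∧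
        Odd (ArithmeticFunction.cardFactors (α * n + β).toNat)) := by
    rw [hQset]; simp only [hfm]
  have hα'0 : 0 < α.toNat := by omega
  have hαz : α.toNat < z := by omega
  -- the odd rough numbers and the vacuous coprimality conditions
  obtain ⟨Ro, hRo⟩ : ∃ Ro : ℝ, Ro = (#((roughIcc z y).filter (fun b : ℕ =>
      Odd (ArithmeticFunction.cardFactors b))) : ℝ) := ⟨_, rfl⟩
  have hMz : ∀ d : ℕ, d ∣ primesProdBelow z' → ∀ p : ℕ, p.Prime → p ∣ α.toNat * d → p < z := by
    intro d hd
    have hd0 : d ≠ 0 := ne_zero_of_dvd_ne_zero (primesProdBelow_ne_zero z') hd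
    refine prime_dvd_mul_lt hα'0 hαz (fun q hq => ?_) hd0
    rw [hz]
    exact Nat.lt_ceil.mpr ((dvd_primesProdBelow_iff (Nat.prime_of_mem_primeFactors hq) z').mp
      ((Nat.dvd_of_mem_primeFactors hq).trans hd))
  have hE' : ∀ d : ℕ, d ∣ primesProdBelow z' → ∀ a : ℕ, a.Coprime (α.toNat * d) →
      |(#((roughIcc z y).filter (fun b : ℕ =>
          Odd (ArithmeticFunction.cardFactors b) ∧ b ≡ a [MOD α.toNat * d])) : ℝ) -
        (#((roughIcc z y).filter (fun b : ℕ =>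
          Odd (ArithmeticFunction.cardFactors b) ∧ b.Coprime (α.toNat * d))) : ℝ) /
          Nat.totient (α.toNat * d)| ≤ E (α.toNat * d) := by
    intro d hd a ha
    have hd0 : d ≠ 0 := ne_zero_of_dvd_ne_zero (primesProdBelow_ne_zero z') hd
    exact hE _ a (Nat.mul_pos hα'0 (Nat.pos_of_ne_zero hd0)) ha
  -- the encoding and the sequence
  obtain ⟨N, hN, hN0, hNB⟩ : ∃ N : ℕ → ℕ, (∀ n q : ℕ, q.Prime → (q ∣ N n ↔ q < z ∧ n % q ∈ Ω q)) ∧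
      (∀ n, 0 < N n) ∧ ∀ n, N n ≤ ∏ p ∈ Nat.primesBelow z, p :=
    ⟨fun n => ∏ p ∈ (Nat.primesBelow z).filter (fun p => n % p ∈ Ω p), p,
      fun n q hq => prime_dvd_classProd_iff Ω z n hq, fun n => classProd_pos Ω z n,
      fun n => classProd_le Ω z n⟩
  obtain ⟨B, hB⟩ : ∃ B : ℕ, B = ∏ p ∈ Nat.primesBelow z, p := ⟨_, rfl⟩
  rw [← hB] at hNB
  obtain ⟨Xm, hXm⟩ : ∃ Xm : ℝ, Xm = Ro / Nat.totient α.toNat := ⟨_, rfl⟩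
  have hXm0 : 0 ≤ Xm := by rw [hXm, hRo]; positivity
  obtain ⟨A, ha, hsize, hdens⟩ : ∃ A : SieveSequence, (∀ v, A.a v = (#{n ∈ Qset | N n = v} : ℝ)) ∧
      (∀ t, A.size t = Xm) ∧ A.density = g :=
    ⟨⟨fun v => (#{n ∈ Qset | N n = v} : ℝ), fun _ => Nat.cast_nonneg _, fun _ => Xm, g,
      BoundedClassDensity.isMultiplicative_of_apply_eq_prod hg⟩, fun _ => rfl, fun _ => rfl, rfl⟩
  have hdimA : HasSieveDimension A.density κ K := by rw [hdens]; exact hdim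
  have h := hFL A hdimA (B : ℝ) z' D hz' hzD (by rw [hsize]; exact hXm0)
  -- the sifting function
  obtain ⟨Sset, hSset⟩ : ∃ Sset : Finset ℕ,
      Sset = Qset.filter (fun n => ∀ p ∈ Nat.primesBelow z, n % p ∉ Ω p) := ⟨_, rfl⟩
  have hSift : A.sifted B (primesProdBelow z') = #Sset := by
    have hset : Qset.filter (fun n => (N n).Coprime (primesProdBelow z')) = Sset := by
      rw [hSset]
      refine Finset.filter_congr fun n _ => ?_
      rw [coprime_primesProdBelow_iff, ← hz]
      refine forall₂_congr fun q hq => ?_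
      rw [Nat.mem_primesBelow] at hq
      rw [hN n q hq.2]
      exact ⟨fun h1 h2 => h1 ⟨hq.1, h2⟩, fun h1 h2 => h1 h2.2⟩
    rw [sifted_eq ha hN0 hNB, hset]
  -- the main term
  have hV : A.densityProduct (primesProdBelow z') = W := by
    rw [SieveSequence.densityProduct, primeFactors_primesProdBelow, hdens, ← hz, hW]
  have hW0 : 0 < W := by
    rw [hW]
    exact prod_pos fun p hp => sub_pos.mpr (hdim.1 p (Nat.prime_of_mem_primesBelow hp)).2
  -- `S(ℬ, z)` against `O`
  have hPS1 : #Pset ≤ #Sset := by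
    rw [hPset, hSset, hQset]
    refine card_le_card fun n hn => ?_
    rw [mem_filter, mem_filter] at hn
    obtain ⟨⟨hnI, hall⟩, hΩ1⟩ := hn
    rw [mem_filter, mem_filter]
    refine ⟨⟨hnI, hall m, hΩ1⟩, fun p hp hmem => ?_⟩
    rw [hΩ, mem_filter] at hmem
    obtain ⟨-, -, i, -, hi⟩ := hmem
    rw [Nat.mem_primesBelow] at hp
    exact (hall i).2 p (mem_range.mpr hp.1) hp.2 ((dvd_eval_iff_dvd_eval_mod (f i) p n).mpr hi)
  have hPS2 : #Sset ≤ #Pset + n₀ := by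
    calc #Sset ≤ #(Pset ∪ range n₀) := card_le_card fun n hn => ?_
      _ ≤ #Pset + n₀ := (card_union_le _ _).trans (by rw [card_range])
    rw [hSset, hQset, mem_filter, mem_filter] at hn
    obtain ⟨⟨hnI, ⟨-, hrough⟩, hΩ1⟩, hsift⟩ := hn
    rw [mem_union, mem_range, hPset, mem_filter, mem_filter]
    by_cases hnn : n₀ ≤ n
    · refine Or.inl ⟨⟨hnI, fun i => ⟨hn₀ i n hnn, fun p hp hpp hdvd => ?_⟩⟩, hΩ1⟩
      by_cases him : i = m
      · subst him; exact hrough p hp hpp hdvd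
      · refine hsift p (Nat.mem_primesBelow.mpr ⟨mem_range.mp hp, hpp⟩) ?_
        rw [hΩ, mem_filter]
        exact ⟨mem_range.mpr (Nat.mod_lt n hpp.pos),
          fun h' => hrough p hp hpp ((dvd_eval_iff_dvd_eval_mod (f m) p n).mpr h'), i, him,
          (dvd_eval_iff_dvd_eval_mod (f i) p n).mp hdvd⟩
    · exact Or.inr (not_le.mp hnn)
  -- the remainders
  have hRd : ∀ d ∈ (primesProdBelow z').divisors.filter (fun d : ℕ => (d : ℝ) ≤ D),
      |A.remainder d B| ≤ (S : ℝ) ^ ArithmeticFunction.cardDistinctFactors d * E (α.toNat * d) := by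
    intro d hd
    rw [Finset.mem_filter, Nat.mem_divisors] at hd
    have hsq : Squarefree d := (squarefree_primesProdBelow z').squarefree_of_dvd hd.1.1
    have hdM : ∀ q ∈ d.primeFactors, q < z := fun q hq => by
      rw [hz]
      exact Nat.lt_ceil.mpr ((dvd_primesProdBelow_iff (Nat.prime_of_mem_primeFactors hq) z').mp
        ((Nat.dvd_of_mem_primeFactors hq).trans hd.1.1))
    have hcongr : A.congrSum d B =
        #(Qset.filter (fun n : ℕ => ∀ q ∈ d.primeFactors, n % q ∈ Ω q)) := by
      have hset : Qset.filter (fun n => d ∣ N n) =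
          Qset.filter (fun n : ℕ => ∀ q ∈ d.primeFactors, n % q ∈ Ω q) := by
        refine Finset.filter_congr fun n _ => ?_
        rw [dvd_iff_forall_primeFactors hN hsq]
        exact forall₂_congr fun q hq => and_iff_right (hdM q hq)
      rw [congrSum_eq ha hN0 hNB, hset]
    rw [SieveSequence.remainder, hcongr, hdens, hsize, hQset', hXm, hRo, hy]
    have hE'' := hE' d hd.1.1
    rw [hy] at hE''
    exact abs_card_classes_sub_le hf hΩ hΦ hα hfm hαβ hg hS hsq hzβ (hMz d hd.1.1) hE''
  have hRsum : ∑ d ∈ (primesProdBelow z').divisors.filter (fun d : ℕ => (d : ℝ) ≤ D),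
      |A.remainder d B| ≤ R := by
    rw [hR]
    exact sum_le_sum hRd
  -- `N` against the size `X`
  have hQX : |(#Qset : ℝ) - Xm| ≤ E₁ := by
    have hc' : ∀ q ∈ (1 : ℕ).primeFactors, ¬ ((q : ℤ) ∣ α * ((0 : ℕ) : ℤ) + β) := by
      simp [Nat.primeFactors_one]
    obtain ⟨u, hu⟩ := isUnit_linear_class hα hαβ one_ne_zero hc'
    haveI : NeZero (α.toNat * 1) := ⟨by omega⟩
    have ha1 : (((u : ZMod (α.toNat * 1)).val : ℕ) : ZMod (α.toNat * 1)) =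
        ((α * ((0 : ℕ) : ℤ) + β : ℤ) : ZMod (α.toNat * 1)) := by rw [ZMod.natCast_zmod_val, hu]
    have hcount := card_filter_mod_eq (x := x) hα Nat.zero_lt_one hzβ ha1
    rw [← hy, ← hQset', filter_true_of_mem fun n _ => Nat.mod_one n] at hcount
    have h1d : (1 : ℕ) ∣ primesProdBelow z' := one_dvd _
    have hb := hE' 1 h1d _ (ZMod.val_coe_unit_coprime u)
    rw [← hcount, filter_and_coprime_eq (hMz 1 h1d), ← hRo, mul_one, ← hXm, ← hE₁] at hb
    exact hb
  -- combination
  have hP1 : (#Pset : ℝ) ≤ #Sset := by exact_mod_cast hPS1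
  have hP2 : (#Sset : ℝ) ≤ #Pset + n₀ := by exact_mod_cast hPS2
  have hXQ : Xm ≤ #Qset + E₁ := by have := (abs_le.mp hQX).1; linarith
  set e : ℝ := Real.exp (-(Real.log D / Real.log z')) with he
  have he0 : 0 ≤ e := Real.exp_nonneg _
  rw [hSift, hsize, hV] at h
  have hn0 : (0 : ℝ) ≤ n₀ := Nat.cast_nonneg _
  have h1 : |(#Pset : ℝ) - #Sset| ≤ n₀ := abs_sub_le_iff.mpr ⟨by linarith, by linarith⟩
  have h2 : |(#Sset : ℝ) - Xm * W| ≤ C₀ * e * W * (#Qset + E₁) + R := by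
    refine h.trans (add_le_add ?_ hRsum)
    calc C₀ * Xm * W * e = C₀ * e * W * Xm := by ring
      _ ≤ C₀ * e * W * (#Qset + E₁) :=
          mul_le_mul_of_nonneg_left hXQ (mul_nonneg (mul_nonneg hC₀ he0) hW0.le)
  have h3 : |Xm * W - W * #Qset| ≤ W * E₁ := by
    rw [show Xm * W - W * #Qset = W * ((#Qset : ℝ) - Xm) * (-1) by ring, abs_mul, abs_mul,
      abs_of_pos hW0, abs_neg, abs_one, mul_one]
    exact mul_le_mul_of_nonneg_left hQX hW0.le
  calc |(#Pset : ℝ) - W * #Qset|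
      ≤ |(#Pset : ℝ) - #Sset| + |(#Sset : ℝ) - W * #Qset| := abs_sub_le _ _ _
    _ ≤ |(#Pset : ℝ) - #Sset| + (|(#Sset : ℝ) - Xm * W| + |Xm * W - W * #Qset|) :=
        add_le_add le_rfl (abs_sub_le _ _ _)
    _ ≤ n₀ + (C₀ * e * W * (#Qset + E₁) + R + W * E₁) := add_le_add h1 (by linarith)
    _ = _ := by ring

end SieveDecouplingOdd

/-- **Sub-goal (the odd decoupling sieve at a fixed height)** of the stub
`stub_sieveDecouplingOdd_of_roughCellsBV` (crux stmt-Parity-15629, line `birth`): the inequality of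
`SieveDecouplingOdd.sieve_at` with the classes `Ω p`, `Φ p` written out. [folklore] -/
theorem stub_decouplingOddSieveAt :
    ∀ (k : ℕ) (f : Fin k → Polynomial ℤ), Literature.NumberTheory.Sieve.IsBatemanHornSystem f → ∀ (m
    : Fin k) (α β : ℤ), 0 < α → (∀ n : ℤ, (f m).eval n = α * n + β) → (∀ p : ℕ, p.Prime → (p : ℤ) ∣
    α → ¬ ((p : ℤ) ∣ β)) → ∀ (g : ArithmeticFunction ℝ), (∀ d : ℕ, d ≠ 0 → g d = ∏ p ∈
    d.primeFactors, ((((Finset.range p).filter (fun c : ℕ => ¬ ((p : ℤ) ∣ (f m).eval (c : ℤ)) ∧ ∃ i,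
    i ≠ m ∧ (p : ℤ) ∣ (f i).eval (c : ℤ))).card : ℕ) : ℝ) / ((((Finset.range p).filter (fun c : ℕ =>
    ¬ ((p : ℤ) ∣ (f m).eval (c : ℤ)))).card : ℕ) : ℝ)) → ∀ (κ K C₀ : ℝ),
    Literature.NumberTheory.Sieve.HasSieveDimension g κ K → 0 ≤ C₀ → (∀ A :
    Literature.NumberTheory.Sieve.SieveSequence, Literature.NumberTheory.Sieve.HasSieveDimension
    A.density κ K → ∀ x z D : ℝ, 2 ≤ z → z ≤ D → 0 ≤ A.size x → |A.sifted x
    (Literature.NumberTheory.Sieve.primesProdBelow z) - A.size x * A.densityProduct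
    (Literature.NumberTheory.Sieve.primesProdBelow z)| ≤ C₀ * A.size x * A.densityProduct
    (Literature.NumberTheory.Sieve.primesProdBelow z) * Real.exp (-(Real.log D / Real.log z)) + ∑ d
    ∈ (Literature.NumberTheory.Sieve.primesProdBelow z).divisors.filter (fun d : ℕ => (d : ℝ) ≤ D),
    |A.remainder d x|) → ∀ (S : ℕ), (∀ p : ℕ, p.Prime → ((Finset.range p).filter (fun c : ℕ => ¬ ((p
    : ℤ) ∣ (f m).eval (c : ℤ)) ∧ ∃ i, i ≠ m ∧ (p : ℤ) ∣ (f i).eval (c : ℤ))).card ≤ S) → ∀ (n₀ : ℕ),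
    (∀ i, ∀ n : ℕ, n₀ ≤ n → 0 < (f i).eval (n : ℤ)) → ∀ (x : ℕ) (z' D : ℝ), 2 ≤ z' → z' ≤ D → β <
    ⌈z'⌉₊ → α < ⌈z'⌉₊ → ∀ (E : ℕ → ℝ), (∀ q a : ℕ, 0 < q → a.Coprime q →
    |((((Literature.NumberTheory.Sieve.roughIcc ⌈z'⌉₊ (α * x + β).toNat).filter (fun b : ℕ => Odd
    (ArithmeticFunction.cardFactors b) ∧ Nat.ModEq q b a)).card : ℕ) : ℝ) -
    ((((Literature.NumberTheory.Sieve.roughIcc ⌈z'⌉₊ (α * x + β).toNat).filter (fun b : ℕ => Odd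
    (ArithmeticFunction.cardFactors b) ∧ b.Coprime q)).card : ℕ) : ℝ) / ((Nat.totient q : ℕ) : ℝ)| ≤
    E q) → |(((((Finset.Icc 1 x).filter (fun n : ℕ => ∀ i, 0 < (f i).eval (n : ℤ) ∧ ∀ p ∈
    Finset.range ⌈z'⌉₊, p.Prime → ¬ ((p : ℤ) ∣ (f i).eval (n : ℤ)))).filter (fun n : ℕ => Odd
    (ArithmeticFunction.cardFactors (((f m).eval (n : ℤ)).toNat)))).card : ℕ) : ℝ) - (∏ p ∈
    Nat.primesBelow ⌈z'⌉₊, (1 - g p)) * ((((Finset.Icc 1 x).filter (fun n : ℕ => (0 < (f m).eval (n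
    : ℤ) ∧ ∀ p ∈ Finset.range ⌈z'⌉₊, p.Prime → ¬ ((p : ℤ) ∣ (f m).eval (n : ℤ))) ∧ Odd
    (ArithmeticFunction.cardFactors (((f m).eval (n : ℤ)).toNat)))).card : ℕ) : ℝ)| ≤ n₀ + C₀ *
    Real.exp (-(Real.log D / Real.log z')) * (∏ p ∈ Nat.primesBelow ⌈z'⌉₊, (1 - g p)) *
    (((((Finset.Icc 1 x).filter (fun n : ℕ => (0 < (f m).eval (n : ℤ) ∧ ∀ p ∈ Finset.range ⌈z'⌉₊,
    p.Prime → ¬ ((p : ℤ) ∣ (f m).eval (n : ℤ))) ∧ Odd (ArithmeticFunction.cardFactors (((f m).eval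
    (n : ℤ)).toNat)))).card : ℕ) : ℝ) + (E α.toNat)) + (∑ d ∈
    (Literature.NumberTheory.Sieve.primesProdBelow z').divisors.filter (fun d : ℕ => (d : ℝ) ≤ D),
    (S : ℝ) ^ ArithmeticFunction.cardDistinctFactors d * E (α.toNat * d)) + (∏ p ∈ Nat.primesBelow
    ⌈z'⌉₊, (1 - g p)) * (E α.toNat)
 :=
  fun _ f hf m _ _ hα hfm hαβ _ hg _ _ _ hdim hC₀ hFL _ hS _ hn₀ _ _ _ hz' hzD hzβ hzα _ hE =>
    SieveDecouplingOdd.sieve_at hf (m := m)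
      (Ω := fun p => (Finset.range p).filter (fun c : ℕ => ¬ ((p : ℤ) ∣ (f m).eval (c : ℤ)) ∧
        ∃ i, i ≠ m ∧ (p : ℤ) ∣ (f i).eval (c : ℤ)))
      (Φ := fun p => (Finset.range p).filter (fun c : ℕ => ¬ ((p : ℤ) ∣ (f m).eval (c : ℤ))))
      (fun _ => rfl) (fun _ => rfl) hα hfm hαβ hg hdim hC₀ hFL hS hn₀ hz' hzD hzβ hzα hE

end Summit.Parity.BatemanHorn.Cruxes.OddSectorShareLinear.Birth

end
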